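import Mathlib
import Literature.MathematicalPhysics.QuantumFieldTheory.PlaquetteRandomCluster
import HarnessLib

/-!
# Potts lattice gauge theory on the torus, Wilson loop variables, and the generalised
# Edwards–Sokal coupling with the plaquette random-cluster model (Duncan–Schweinhart, CMP 406 (2025), §1.1 and §5)

Second file of the transcription of the Fortuin–Kasteleyn-type representation of `q`-state Potts
lattice gauge theory (companion of `PlaquetteRandomCluster`, whose module docstring states the
setting, the readings (R1)–(R3), (R7) and the SCOPE caveat: `ℤ_q`/Potts gauge theory only — nothing
here bears on the Yang–Mills mass gap or on `BalabanLadder.IR`; in the `ym` ladder only the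
conditional finite-`𝕋⁴` rung `BalabanLadder.UV` is closed by any route).

Source: P. Duncan, B. Schweinhart, *Topological phases in the plaquette random-cluster model and
Potts lattice gauge theory*, Comm. Math. Phys. **406** (2025), arXiv:2207.08339 (loci of the arXiv
version) [DuncanSchweinhart2025]: §1.1 Definition 2 (Potts lattice gauge theory), Definition 3
(generalised Wilson loop variables), the event `V_γ`; §5 Proposition 20 (the coupling, after
Hiraoka–Shirai) and Proposition 21 (its conditional laws). We type the case `i = 2` (spins on the
EDGES of the torus `𝕋^d_L`, interaction on plaquettes), in the vocabulary of `PlaquetteRandomCluster`.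

## Readings (transcriber's)

* (R4) The source DEFINES the coboundary through the boundary: "`δ` is the coboundary operator
  `δf(σ) = f(∂σ)`" (Def. 2). Accordingly the boundary `bd₂ c ∈ C₁` of a plaquette `2`-chain `c` is
  typed as the transpose of the tree's `td₁` in the cell bases, `(∂c)(e) := Σ_σ c(σ)·(td₁ 𝟙_e)(σ)`,
  and `bd₁` is the transpose of `td₀`; the bilinear adjunction `⟨θ, ∂c⟩ = ⟨δθ, c⟩` is then PROVED
  (`pairing_bd₂`). The event `V_γ` ("`γ` is null-homologous in `P`": `γ = ∂ρ` for a chain `ρ` of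
  `P`) is `IsNullHomologousIn ω γ := ∃ c supported on ω, bd₂ c = γ`.
* (R5) `q`-state theory: coefficients `𝔽_q = ZMod q`; `(f(γ))^ℂ`, "the corresponding `q`-th root
  of unity", is `ZMod.stdAddChar (f(γ)) = e^{2πi f(γ)/q}`.
* (R6) Sign of the Hamiltonian: `H(f) = -Σ_σ K(δf(σ), 0)` so that `e^{-βH(f)} = e^{β #{σ : δf(σ)=0}}`
  is ferromagnetic. This is eq. (1) of Def. 2 in the companion paper (Duncan–Schweinhart,
  *A sharp deconfinement transition for Potts lattice gauge theory in codimension two*, CMP 2025,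
  arXiv:2308.07534) and is what the proof of Prop. 20 computes
  (`∏_σ [e^{-β} + (1 - e^{-β}) K(δf(σ),0)] = e^{-β|X^i|} e^{-βH(f)}`); in [DuncanSchweinhart2025]
  Def. 2 the Kronecker delta is printed against the identity written multiplicatively.
* The gauge group of Definition 2 is any finite abelian group `𝒢`; we type a finite additive
  commutative group `G` (`q`-state: `G = ZMod q`).

## Contents (everything PROVED; no named fact is introduced)

* `flatCount`, `hamiltonian`, `pottsWeight`, `pottsPartitionFn`, `pottsProb`, `pottsExpect`
  (Def. 2), normalisation;
* chains: `pairing` (`f(γ)`), `pairing₂`, `edgeInd`, `vertInd`, `bd₂`, `bd₁`, `IsOneCycle`,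
  `IsNullHomologousIn` (`V_γ`), `sum_smul_edgeInd`, `pairing_bd₂` (`∂ = δᵀ`),
  `pairing_eq_zero_of_isNullHomologousIn` (cocycles kill boundaries); `wilsonLoopVar` (Def. 3);
* the generalised Edwards–Sokal coupling `esWeight` with `p = esParam β = 1 - e^{-β}` (Prop. 20):
  `esWeight_eq_ite` (Prop. 21: given `ω`, the weight is the indicator of `Z¹(P(ω))` times
  `p^{|ω|}(1-p)^{|ωᶜ|}`), first marginal `sum_esWeight_eq_pottsWeight`
  (`Σ_ω κ = e^{-β|X²|} e^{-βH}`), second marginal `sum_esWeight_eq_card`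
  (`Σ_f κ = p^{|ω|}(1-p)^{|ωᶜ|} |Z¹(P(ω); G)|`) and `card_flatCochains_eq`
  (`|Z¹(P(ω); G)| = |H¹(P(ω); G)| · |B¹|`, so the second marginal is the `|H¹|`-weighted plaquette
  random-cluster model `weightGrp`, `= q^{b₁}`-weighted for `G = 𝔽_q`: `sum_esWeight_eq_weight`).
-/

open Finset

namespace Literature.MathematicalPhysics.QuantumFieldTheory

namespace PlaquetteRC

open LatticeForm

variable {d L : ℕ}

/-! ### Potts lattice gauge theory (Definition 2, spins on edges) -/

section Potts

variable [NeZero L] (G : Type*) [AddCommGroup G] [DecidableEq G]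

/-- The number of FLAT plaquettes of the edge cochain `θ`: `#{σ ∈ X² : δθ(σ) = 0}`. [cite: DuncanSchweinhart2025, §1.1 Def. 2] -/
def flatCount (θ : Site d L → Fin d → G) : ℕ :=
  (Finset.univ.filter fun p : Plaquette d L => res (td₁ θ) p = 0).card

/-- The Potts-gauge Hamiltonian `H(f) = -Σ_σ K(δf(σ), 0)` (reading R6). [cite: DuncanSchweinhart2025, §1.1 Def. 2 eq. (1)] -/
def hamiltonian (θ : Site d L → Fin d → G) : ℝ := -(flatCount G θ : ℝ)

/-- The Potts-gauge Boltzmann weight `e^{-β H(f)} = e^{β #{flat plaquettes}}`. [cite: DuncanSchweinhart2025, §1.1 Def. 2] -/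
noncomputable def pottsWeight (β : ℝ) (θ : Site d L → Fin d → G) : ℝ :=
  Real.exp (-β * hamiltonian G θ)

/-- `e^{-βH(f)} = e^{β · flatCount f}`. [cite: DuncanSchweinhart2025, §1.1 Def. 2] -/
theorem pottsWeight_eq (β : ℝ) (θ : Site d L → Fin d → G) :
    pottsWeight G β θ = Real.exp (β * flatCount G θ) := by
  simp [pottsWeight, hamiltonian]

/-- The Boltzmann weights are positive. [cite: DuncanSchweinhart2025, §1.1 Def. 2] -/
theorem pottsWeight_pos (β : ℝ) (θ : Site d L → Fin d → G) : 0 < pottsWeight G β θ :=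
  Real.exp_pos _

variable [Fintype G]

/-- The normalising constant `𝒵(X, β, 𝒢, 1, d) = Σ_f e^{-βH(f)}` of Potts lattice gauge theory
(finite sum over `G`-valued edge cochains of the torus). [cite: DuncanSchweinhart2025, §1.1 Def. 2] -/
noncomputable def pottsPartitionFn (β : ℝ) : ℝ := ∑ θ : Site d L → Fin d → G, pottsWeight G β θ

/-- `𝒵 > 0`. [cite: DuncanSchweinhart2025, §1.1 Def. 2] -/
theorem pottsPartitionFn_pos (β : ℝ) : 0 < pottsPartitionFn (d := d) (L := L) G β :=
  Finset.sum_pos (fun θ _ => pottsWeight_pos G β θ) Finset.univ_nonempty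

/-- The Potts lattice gauge theory probability `ν_{X,β,𝒢,1,d}(f) = e^{-βH(f)}/𝒵` of one edge
cochain (free = periodic torus volume, reading R7 of the companion file). [cite: DuncanSchweinhart2025, §1.1 Def. 2] -/
noncomputable def pottsProb (β : ℝ) (θ : Site d L → Fin d → G) : ℝ :=
  pottsWeight G β θ / pottsPartitionFn (d := d) (L := L) G β

/-- Expectation `𝔼_ν(F)` of a complex observable under Potts lattice gauge theory. [cite: DuncanSchweinhart2025, §1.1 Def. 2] -/
noncomputable def pottsExpect (β : ℝ) (F : (Site d L → Fin d → G) → ℂ) : ℂ :=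
  ∑ θ : Site d L → Fin d → G, (pottsProb G β θ : ℂ) * F θ

/-- `ν` is a probability: `Σ_f ν(f) = 1`. [cite: DuncanSchweinhart2025, §1.1 Def. 2] -/
theorem sum_pottsProb_eq_one (β : ℝ) : ∑ θ : Site d L → Fin d → G, pottsProb G β θ = 1 := by
  unfold pottsProb
  rw [← Finset.sum_div, div_eq_one_iff_eq (pottsPartitionFn_pos G β).ne']
  rfl

end Potts

/-! ### Chains, the boundary operator as the transpose of `δ`, Wilson loop variables -/

section Chains

variable [NeZero L] {R : Type*} [CommRing R]

/-- The evaluation `f(γ) = ⟨f, γ⟩ = Σ_e f(e) γ(e)` of a `1`-cochain `f = θ` on a `1`-chain `γ`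
(both functions on positively oriented edges). [cite: DuncanSchweinhart2025, §1.1 Def. 3 (f(γ))] -/
def pairing (θ γ : Site d L → Fin d → R) : R := ∑ x : Site d L, ∑ i : Fin d, θ x i * γ x i

/-- The pairing of plaquette functions `⟨η, c⟩ = Σ_σ η(σ) c(σ)` (a `2`-cochain on a `2`-chain).
[cite: DuncanSchweinhart2025, §1.1 Def. 2 (δf(σ) = f(∂σ))] -/
def pairing₂ (η c : Plaquette d L → R) : R := ∑ σ : Plaquette d L, η σ * c σ

/-- The indicator cochain `𝟙_e` of the positively oriented edge `e = (x, k)` (cell basis of `C¹`).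
[cite: DuncanSchweinhart2025, §2.1 (chains = linear combinations of plaquettes)] -/
def edgeInd (x : Site d L) (k : Fin d) : Site d L → Fin d → R :=
  fun y l => if y = x ∧ l = k then 1 else 0

/-- The indicator `0`-cochain `𝟙_x` of a site (cell basis of `C⁰`). [cite: DuncanSchweinhart2025, §2.1] -/
def vertInd (x : Site d L) : Site d L → R := fun y => if y = x then 1 else 0

/-- The boundary `∂c ∈ C₁` of a plaquette `2`-chain `c`, the transpose of the coboundary `td₁` in
the cell bases: `(∂c)(e) = Σ_σ c(σ) (δ𝟙_e)(σ)` (reading R4). [cite: DuncanSchweinhart2025, §1.1 Def. 2 (δf(σ) = f(∂σ)) and §2.1 (∂ of a plaquette)] -/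
def bd₂ (c : Plaquette d L → R) : Site d L → Fin d → R :=
  fun x k => ∑ σ : Plaquette d L, c σ * res (td₁ (edgeInd (R := R) x k)) σ

/-- The boundary `∂γ ∈ C₀` of a `1`-chain, the transpose of `td₀`: `(∂γ)(x) = Σ_e γ(e) (δ𝟙_x)(e)`
(so `∂(y → y+eᵢ) = (y+eᵢ) - y`). [cite: DuncanSchweinhart2025, §2.1 (boundary of an edge)] -/
def bd₁ (γ : Site d L → Fin d → R) : Site d L → R :=
  fun x => ∑ y : Site d L, ∑ i : Fin d, γ y i * td₀ (vertInd (R := R) x) y i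

/-- A `1`-cycle: `∂γ = 0` (the loops on which Wilson loop variables are evaluated). [cite: DuncanSchweinhart2025, §2.1 (cycles Z_i)] -/
def IsOneCycle (γ : Site d L → Fin d → R) : Prop := bd₁ γ = 0

/-- **The event `V_γ`**: the `1`-chain `γ` is NULL-HOMOLOGOUS in the plaquette complex `P(ω)`:
`γ = ∂c` for a `2`-chain `c` supported on the open plaquettes ("bounded by a surface of
plaquettes", with `R`-coefficients). [cite: DuncanSchweinhart2025, §1.1 (V_γ, before Thm. 5)] -/
def IsNullHomologousIn (ω : Finset (Plaquette d L)) (γ : Site d L → Fin d → R) : Prop :=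
  ∃ c : Plaquette d L → R, (∀ σ, σ ∉ ω → c σ = 0) ∧ bd₂ c = γ

/-- Expansion of a `1`-cochain in the edge basis: `θ = Σ_e θ(e) 𝟙_e`. [cite: DuncanSchweinhart2025, §2.1] -/
theorem sum_smul_edgeInd (θ : Site d L → Fin d → R) :
    (∑ x : Site d L, ∑ k : Fin d, θ x k • edgeInd (R := R) x k) = θ := by
  funext y l
  simp only [Finset.sum_apply, Pi.smul_apply, edgeInd, smul_eq_mul, mul_ite, mul_one, mul_zero]
  rw [Finset.sum_eq_single y]
  · rw [Finset.sum_eq_single l]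
    · simp
    · intro k _ hk; simp [Ne.symm hk]
    · intro h; exact absurd (Finset.mem_univ l) h
  · intro x _ hx; exact Finset.sum_eq_zero fun k _ => by simp [Ne.symm hx]
  · intro h; exact absurd (Finset.mem_univ y) h

/-- **`∂` is the transpose of `δ`**: `⟨θ, ∂c⟩ = ⟨δθ, c⟩` for every `1`-cochain `θ` and plaquette
`2`-chain `c` — the relation `δf(σ) = f(∂σ)` extended bilinearly. [cite: DuncanSchweinhart2025, §1.1 Def. 2 (δf(σ) = f(∂σ))] -/
theorem pairing_bd₂ (θ : Site d L → Fin d → R) (c : Plaquette d L → R) :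
    pairing θ (bd₂ c) = pairing₂ (res (td₁ θ)) c := by
  unfold pairing bd₂ pairing₂
  have hlin : ∀ σ : Plaquette d L,
      res (td₁ θ) σ = ∑ x : Site d L, ∑ k : Fin d, θ x k * res (td₁ (edgeInd (R := R) x k)) σ := by
    intro σ
    conv_lhs => rw [← sum_smul_edgeInd θ]
    rw [td₁_sum]
    simp only [res, Finset.sum_apply]
    refine Finset.sum_congr rfl fun x _ => ?_
    rw [td₁_sum]
    simp only [Finset.sum_apply]
    refine Finset.sum_congr rfl fun k _ => ?_
    rw [td₁_smul]
    simp [smul_eq_mul]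
  simp_rw [hlin, Finset.mul_sum, Finset.sum_mul]
  -- LHS `Σ_x Σ_k Σ_σ`, RHS `Σ_σ Σ_x Σ_k`: bring the RHS to the LHS order
  conv_rhs => rw [Finset.sum_comm]
  refine Finset.sum_congr rfl fun x _ => ?_
  conv_rhs => rw [Finset.sum_comm]
  refine Finset.sum_congr rfl fun k _ => ?_
  refine Finset.sum_congr rfl fun σ _ => ?_
  ring

/-- Cocycles annihilate boundaries: if `θ` is flat on `ω` and `γ` is null-homologous in `P(ω)`
then `θ(γ) = 0` (the easy half of the duality `B₁(P) = Z¹(P)^⊥` used in the proof of Theorem 5).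
[cite: DuncanSchweinhart2025, §5 (proof of Thm. 5)] -/
theorem pairing_eq_zero_of_isNullHomologousIn {ω : Finset (Plaquette d L)}
    {θ γ : Site d L → Fin d → R} (hθ : θ ∈ flatCochains R R ω) (hγ : IsNullHomologousIn ω γ) :
    pairing θ γ = 0 := by
  obtain ⟨c, hc, rfl⟩ := hγ
  rw [pairing_bd₂]
  unfold pairing₂
  refine Finset.sum_eq_zero fun σ _ => ?_
  by_cases hσ : σ ∈ ω
  · rw [hθ σ hσ, zero_mul]
  · rw [hc σ hσ, mul_zero]

variable (q : ℕ) [NeZero q]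

/-- **The (generalised) Wilson loop variable** of `q`-state Potts lattice gauge theory:
`W_γ(f) = (f(γ))^ℂ = e^{2πi f(γ)/q}`, the `q`-th root of unity attached to `f(γ) ∈ ℤ_q`
(Definition 3, reading R5; `γ` is meant to be a `1`-cycle). [cite: DuncanSchweinhart2025, §1.1 Def. 3] -/
noncomputable def wilsonLoopVar (γ θ : Site d L → Fin d → ZMod q) : ℂ :=
  ZMod.stdAddChar (pairing θ γ)

/-- `|W_γ(f)| = 1`. [cite: DuncanSchweinhart2025, §1.1 Def. 3] -/
theorem norm_wilsonLoopVar (γ θ : Site d L → Fin d → ZMod q) : ‖wilsonLoopVar q γ θ‖ = 1 := by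
  rw [wilsonLoopVar, ZMod.stdAddChar_apply, Circle.norm_coe]

end Chains

/-! ### The generalised Edwards–Sokal coupling (Propositions 20 and 21) -/

section EdwardsSokal

variable [NeZero L] (G : Type*) [AddCommGroup G] [DecidableEq G]

/-- The coupling parameter `p = 1 - e^{-β}`. [cite: DuncanSchweinhart2025, Prop. 20] -/
noncomputable def esParam (β : ℝ) : ℝ := 1 - Real.exp (-β)

/-- `1 - p = e^{-β}`. [cite: DuncanSchweinhart2025, Prop. 20] -/
theorem one_sub_esParam (β : ℝ) : 1 - esParam β = Real.exp (-β) := by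
  simp [esParam]

/-- For `β ≥ 0`, `p = 1 - e^{-β} ∈ [0, 1)`. [cite: DuncanSchweinhart2025, Prop. 20] -/
theorem esParam_mem_Ico {β : ℝ} (hβ : 0 ≤ β) : esParam β ∈ Set.Ico (0 : ℝ) 1 := by
  constructor
  · simp only [esParam, sub_nonneg]; exact Real.exp_le_one_iff.mpr (by linarith)
  · simp only [esParam]; linarith [Real.exp_pos (-β)]

/-- **The Edwards–Sokal–Hiraoka–Shirai coupling weight** on (edge cochain, plaquette configuration)
pairs: `κ(f, ω) ∝ ∏_σ [(1-p) K(ω(σ),0) + p K(ω(σ),1) K(δf(σ),0)]`, `p = 1 - e^{-β}` (`ω` = the set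
of open plaquettes). [cite: DuncanSchweinhart2025, Prop. 20] -/
noncomputable def esWeight (β : ℝ) (θ : Site d L → Fin d → G) (ω : Finset (Plaquette d L)) : ℝ :=
  ∏ σ : Plaquette d L,
    (if σ ∈ ω then esParam β * (if res (td₁ θ) σ = 0 then 1 else 0) else 1 - esParam β)

/-- `∏_σ (if σ ∈ ω then f σ else g σ) = ∏_{σ ∈ ω} f σ · ∏_{σ ∉ ω} g σ` (plumbing for the
product expansion in the proof of Prop. 20). [folklore] -/
private theorem prod_ite_mem_eq (ω : Finset (Plaquette d L)) (f g : Plaquette d L → ℝ) :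
    ∏ σ : Plaquette d L, (if σ ∈ ω then f σ else g σ) = (∏ σ ∈ ω, f σ) * ∏ σ ∈ ωᶜ, g σ := by
  rw [Finset.prod_ite]
  congr 1
  · exact Finset.prod_congr (by ext σ; simp) fun _ _ => rfl
  · exact Finset.prod_congr (by ext σ; simp) fun _ _ => rfl

/-- **Proposition 21 (conditional law given the plaquettes), in weight form**: for a fixed
configuration `ω` the coupling weight is `p^{|ω|} (1-p)^{|ωᶜ|}` times the INDICATOR that `f` is a
cocycle of `P(ω)` — so `κ(· ∣ ω)` is uniform on `Z¹(P(ω); G)`; and for fixed `f` it is a Bernoulli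
product over the plaquettes on which `δf` vanishes (Prop. 21 (1)), which is the definition of
`esWeight`. [cite: DuncanSchweinhart2025, Prop. 21] -/
theorem esWeight_eq_ite (β : ℝ) (θ : Site d L → Fin d → G) (ω : Finset (Plaquette d L)) :
    esWeight G β θ ω =
      if (∀ σ ∈ ω, res (td₁ θ) σ = 0) then esParam β ^ ω.card * (1 - esParam β) ^ ωᶜ.card
      else 0 := by
  unfold esWeight
  rw [prod_ite_mem_eq, Finset.prod_mul_distrib, Finset.prod_const, Finset.prod_const,
    Finset.prod_boole]
  split_ifs <;> ring

/-- **Proposition 20, first marginal**: summing the coupling weight over plaquette configurations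
gives the Potts-gauge weight, `Σ_ω κ(f, ω) = e^{-β|X²|} e^{-βH(f)}`, so the first marginal of the
(normalised) coupling is `ν_{X,β}`. Proof as printed:
`∏_σ [e^{-β} + (1 - e^{-β}) K(δf(σ),0)] = e^{-β|X²|} e^{-βH(f)}`. [cite: DuncanSchweinhart2025, Prop. 20 (first marginal)] -/
theorem sum_esWeight_eq_pottsWeight (β : ℝ) (θ : Site d L → Fin d → G) :
    ∑ ω : Finset (Plaquette d L), esWeight G β θ ω =
      Real.exp (-β * Fintype.card (Plaquette d L)) * pottsWeight G β θ := by
  classical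
  -- product expansion `∏_σ (a_σ + b) = Σ_ω ∏_{σ ∈ ω} a_σ ∏_{σ ∉ ω} b`
  have hexp : ∑ ω : Finset (Plaquette d L), esWeight G β θ ω =
      ∏ σ : Plaquette d L,
        (esParam β * (if res (td₁ θ) σ = 0 then (1 : ℝ) else 0) + (1 - esParam β)) := by
    rw [Finset.prod_add, Finset.powerset_univ]
    refine Finset.sum_congr rfl fun ω _ => ?_
    rw [esWeight, prod_ite_mem_eq, Finset.compl_eq_univ_sdiff]
  rw [hexp]
  -- each factor is `1` on a flat plaquette and `e^{-β}` otherwise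
  have hfac : ∀ σ : Plaquette d L,
      esParam β * (if res (td₁ θ) σ = 0 then (1 : ℝ) else 0) + (1 - esParam β) =
        if res (td₁ θ) σ = 0 then 1 else Real.exp (-β) := by
    intro σ
    split_ifs <;> simp [esParam]
  simp_rw [hfac]
  rw [Finset.prod_ite, Finset.prod_const_one, one_mul, Finset.prod_const, pottsWeight_eq]
  -- `#{non-flat} = |X²| - flatCount`
  have hcard : (Finset.univ.filter fun σ : Plaquette d L => ¬ res (td₁ θ) σ = 0).card +
      flatCount G θ = Fintype.card (Plaquette d L) := by
    unfold flatCount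
    rw [add_comm, Finset.card_filter_add_card_filter_not]
    rfl
  rw [← Real.exp_nat_mul, ← Real.exp_add]
  congr 1
  have : ((Finset.univ.filter fun σ : Plaquette d L => ¬ res (td₁ θ) σ = 0).card : ℝ) =
      Fintype.card (Plaquette d L) - flatCount G θ := by
    rw [← hcard]; push_cast; ring
  rw [this]
  ring

variable [Fintype G]

/-- **Proposition 20, second marginal**: summing the coupling weight over edge cochains gives
`Σ_f κ(f, ω) = p^{|ω|} (1-p)^{|X²|-|ω|} · |Z¹(P(ω); G)|` (the number of cocycles of `P(ω)`),
"the second to last line" of the printed proof. [cite: DuncanSchweinhart2025, Prop. 20 (second marginal)] -/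
theorem sum_esWeight_eq_card (β : ℝ) (ω : Finset (Plaquette d L)) :
    ∑ θ : Site d L → Fin d → G, esWeight G β θ ω =
      esParam β ^ ω.card * (1 - esParam β) ^ ωᶜ.card *
        (Finset.univ.filter fun θ : Site d L → Fin d → G => ∀ σ ∈ ω, res (td₁ θ) σ = 0).card := by
  classical
  have h : ∀ θ : Site d L → Fin d → G, esWeight G β θ ω =
      (if (∀ σ ∈ ω, res (td₁ θ) σ = 0) then (1 : ℝ) else 0) *
        (esParam β ^ ω.card * (1 - esParam β) ^ ωᶜ.card) := by
    intro θ
    rw [esWeight_eq_ite]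
    split_ifs <;> simp
  simp_rw [h]
  rw [← Finset.sum_mul, mul_comm]
  congr 1
  rw [Finset.card_filter]
  push_cast
  rfl

/-- The filter of cochains flat on `ω` counts `Z¹(P(ω); G)`. [cite: DuncanSchweinhart2025, Prop. 20 (second marginal)] -/
theorem card_filter_flat_eq_natCard (R : Type*) [CommRing R] [Module R G] (ω : Finset (Plaquette d L)) :
    (Finset.univ.filter fun θ : Site d L → Fin d → G => ∀ σ ∈ ω, res (td₁ θ) σ = 0).card =
      Nat.card (flatCochains R G ω) := by
  classical
  rw [Nat.card_eq_fintype_card, Fintype.card_subtype]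
  congr 1
  ext θ
  simp only [Finset.mem_filter, Finset.mem_univ, true_and, mem_flatCochains]

omit [NeZero L] in
/-- **`|Z¹(P(ω); G)| = |H¹(P(ω); G)| · |B¹(X; G)|`** (Lagrange), the "last line" of the printed
proof: the second marginal is proportional to the `|H¹|`-weighted plaquette random-cluster weight
`weightGrp`, the factor `|B¹|` not depending on `ω`. [cite: DuncanSchweinhart2025, Prop. 20 (second marginal, "B^{i-1}(P; 𝔽_q) is fixed")] -/
theorem natCard_flatCochains_eq (R : Type*) [CommRing R] (M : Type*) [AddCommGroup M] [Module R M]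
    (ω : Finset (Plaquette d L)) :
    Nat.card (flatCochains (d := d) (L := L) R M ω) =
      cohomologyCard R M ω * Nat.card (gradCochains (d := d) (L := L) R M) := by
  unfold cohomologyCard CohomologyOne
  rw [Submodule.card_eq_card_quotient_mul_card
    (Submodule.comap (flatCochains R M ω).subtype (gradCochains R M)), mul_comm]
  congr 1
  exact Nat.card_congr
    (Submodule.comapSubtypeEquivOfLe (gradCochains_le_flatCochains (R := R) (M := M) ω)).toEquiv

/-- **Proposition 20, second marginal, normalised form**: `Σ_f κ(f, ω) = |B¹(X;G)| · weightGrp G p ω`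
with `p = 1 - e^{-β}`: the plaquette marginal of the coupling is the `|H¹(P;G)|`-weighted plaquette
random-cluster model (for `G = 𝔽_q`, `|H¹| = q^{b₁}`: the model of Definition 1).
[cite: DuncanSchweinhart2025, Prop. 20 (second marginal)] -/
theorem sum_esWeight_eq_weightGrp (β : ℝ) (ω : Finset (Plaquette d L)) :
    ∑ θ : Site d L → Fin d → G, esWeight G β θ ω =
      Nat.card (gradCochains (d := d) (L := L) ℤ G) * weightGrp (d := d) (L := L) G (esParam β) ω := by
  rw [sum_esWeight_eq_card, card_filter_flat_eq_natCard G ℤ, natCard_flatCochains_eq ℤ G, weightGrp]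
  push_cast
  ring

end EdwardsSokal

end PlaquetteRC

end Literature.MathematicalPhysics.QuantumFieldTheory
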